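import Summits.QuantumAdvantage.QuantumAdvantage.Theorems.CharDialJLinGroupLaw
import Summits.QuantumAdvantage.QuantumAdvantage.Theorems.CharDialJLinCore
import HarnessLib

/-!
# Cell qa-qnc0 / decomp-qadv (odd primes): CharDial's item 32604 ⟺ hardness on GROUP-CORES; the LIGHT-COVER rung is a THEOREM

TREE-READY PART 9 of the node `HOME/decomp-qadv-lens-6/g10/CodeDial.lean` (§20–§22), on top of part 8 (the group-peel law) and
part 5 (`CharDialJLinCore`: presentation = data form, `pres_iff_core`, `win_le_of_inactive`, `walkHardFLinSel_of_pres`).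
ZERO hardness `def`s: every class is spelled out.

* `group_peel_law` (`p ≠ 3`): the law with `C = 3`, `ρ = cos(π/3p)`; `hybrid_step_of_group_peel`: it contains part 4's one-cut law;
* `gpeel_to_core` / `gpeel_cover` / `light_step_cost`: group peeling — freeze a LIGHT group while there is one (cost
  `≤ C·p·q^(log₂ n)·2ⁿ` per step, `q = 1/(4p)`), ending in a GROUP-CORE, or — along a LIGHT COVER — in a junta strategy;
* **`data_of_groupCore`**, **`pres_iff_groupCore`** (`p ≠ 3`): item 32604 AT `p` ⟺ hardness on `C'·log₂ n`-GROUP-CORES — a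
  strictly smaller class than part 5's cores (`core_of_groupCore`; the pair-block family of part 11 separates them);
* **`lightCover_hard`** (`p ≠ 3`): UNCONDITIONALLY, junta(`≤ log₂ n`) ⊕ form data admitting a light cover at `L = C'·log₂ n` lose
  α's u-walk game — a new rung containing part 5's exclusive rung and the pair-block family (zero private bits);
* `core_iff_groupCore`: part 5's residual ⟺ this one.
-/

noncomputable section

namespace Summit.QuantumAdvantage.AdviceFreeQNC0.JLinPeel

open Finset Summit.QuantumAdvantage.AdviceFreeQNC0 TwistedTransfer JLinData

/-! ### The law (part 8) packaged; it contains the one-cut hybrid law -/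

/-- **The group-peel law** (`p ≠ 3`; `C = 3`, `ρ = cos(π/(3p))`). -/
theorem group_peel_law (p : ℕ) [Fact p.Prime] (hp3 : p ≠ 3) :
    ∃ C ρ : ℝ, 0 ≤ C ∧ 0 ≤ ρ ∧ ρ < 1 ∧ ∀ (n c : ℕ) (D : JLinData p n) (G : Finset (Fin (n + 1))),
      ∃ κ : Fin (n + 1) → ZMod p,
        (winCount c D.strat : ℝ) ≤ C * D.codeCost G ρ * (2 : ℝ) ^ n + (winCount c (D.freezeAll G κ).strat : ℝ) :=
  ⟨3, Real.cos (Real.pi / (3 * p)), by norm_num, rho_nonneg, rho_lt_one, fun _ c D G => group_peel hp3 c D G⟩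

/-- The group-peel law contains g9's one-step hybrid law (a singleton group; `codeCost ≤ p·ρ^{priv g}`). -/
theorem codeCost_singleton_le {p : ℕ} [Fact p.Prime] {n : ℕ} (D : JLinData p n) (g : Fin (n + 1)) {ρ : ℝ}
    (hρ0 : 0 ≤ ρ) (hρ1 : ρ ≤ 1) : D.codeCost {g} ρ ≤ (p : ℝ) * ρ ^ D.priv g := by
  classical
  unfold codeCost
  have hterm : ∀ t ∈ (tSet p {g}).erase 0, ρ ^ D.privWt {g} t ≤ ρ ^ D.priv g := by
    intro t ht
    apply pow_le_pow_of_le_one hρ0 hρ1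
    have ht0 := Finset.ne_of_mem_erase ht
    have htm := Finset.mem_of_mem_erase ht
    have htg : t g ≠ 0 := by
      intro h0
      apply ht0
      funext g'
      by_cases hgg : g' = g
      · rw [hgg, h0]; rfl
      · exact mem_tSet.1 htm g' (by rwa [mem_singleton])
    unfold priv privWt
    refine card_le_card fun i hi => ?_
    unfold privSet at hi
    rw [mem_filter] at hi
    obtain ⟨hsupp, hJ, hothers⟩ := hi
    unfold suppForm at hsupp
    rw [mem_filter] at hsupp
    rw [mem_filter]
    refine ⟨?_, ?_⟩
    · unfold gPrivSet
      rw [mem_filter]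
      refine ⟨mem_univ _, fun g' => ?_, fun g' hg' => ?_⟩
      · by_cases hgg : g' = g
        · rw [hgg]; exact hJ
        · intro hi'
          exact hothers g' hgg (by unfold readSet; exact mem_union.2 (Or.inl hi'))
      · rw [mem_singleton] at hg'
        by_contra ha
        exact hothers g' hg' (by unfold readSet suppForm; exact mem_union.2 (Or.inr (mem_filter.2 ⟨mem_univ _, ha⟩)))
    · unfold twistVec
      rw [sum_singleton]
      exact mul_ne_zero htg hsupp.2
  calc (∑ t ∈ (tSet p {g}).erase 0, ρ ^ D.privWt {g} t)
      ≤ ∑ t ∈ (tSet p {g}).erase 0, ρ ^ D.priv g := Finset.sum_le_sum hterm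
    _ ≤ ∑ t ∈ tSet p {g}, ρ ^ D.priv g :=
        Finset.sum_le_sum_of_subset_of_nonneg (Finset.erase_subset _ _) (fun _ _ _ => pow_nonneg hρ0 _)
    _ = (p : ℝ) * ρ ^ D.priv g := by
        rw [Finset.sum_const, card_tSet, card_singleton, pow_one, nsmul_eq_mul]

/-- Freezing the singleton group is g9's `freeze`. -/
theorem freezeAll_singleton {p n : ℕ} (D : JLinData p n) (g : Fin (n + 1)) (κ : Fin (n + 1) → ZMod p) :
    D.freezeAll {g} κ = D.freeze g (κ g) := by
  unfold JLinData.freezeAll JLinData.freeze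
  congr 1
  · funext g'
    by_cases h : g' = g
    · subst h; simp
    · simp [h]
  · funext g' u s
    by_cases h : g' = g
    · subst h; simp
    · simp [h]

/-- **The group-peel law implies g9's hybrid law** (singleton groups). -/
theorem hybrid_step_of_group_peel (p : ℕ) [Fact p.Prime]
    (h : ∃ C ρ : ℝ, 0 ≤ C ∧ 0 ≤ ρ ∧ ρ < 1 ∧ ∀ (n c : ℕ) (D : JLinData p n) (G : Finset (Fin (n + 1))),
      ∃ κ : Fin (n + 1) → ZMod p,
        (winCount c D.strat : ℝ) ≤ C * D.codeCost G ρ * (2 : ℝ) ^ n + (winCount c (D.freezeAll G κ).strat : ℝ)) :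
    ∃ C ρ : ℝ, 0 ≤ C ∧ 0 ≤ ρ ∧ ρ < 1 ∧ ∀ (n c : ℕ) (D : JLinData p n) (g : Fin (n + 1)),
      ∃ κ : ZMod p, (winCount c D.strat : ℝ) ≤ C * ρ ^ D.priv g * (2 : ℝ) ^ n + (winCount c (D.freeze g κ).strat : ℝ) := by
  obtain ⟨C, ρ, hC, hρ0, hρ1, hstep⟩ := h
  refine ⟨C * p, ρ, by positivity, hρ0, hρ1, fun n c D g => ?_⟩
  obtain ⟨κ, hκ⟩ := hstep n c D {g}
  refine ⟨κ g, ?_⟩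
  rw [← freezeAll_singleton]
  have hcc := codeCost_singleton_le D g hρ0 hρ1.le
  have h2 : (0 : ℝ) ≤ (2 : ℝ) ^ n := by positivity
  have : C * D.codeCost {g} ρ * (2 : ℝ) ^ n ≤ C * p * ρ ^ D.priv g * (2 : ℝ) ^ n := by
    have := mul_le_mul_of_nonneg_left hcc hC
    nlinarith
  linarith

/-! ### Group peeling: to a group-core, and — along a light cover — to nothing -/

section GPeel

variable {p : ℕ} [Fact p.Prime] {n : ℕ}

/-- **Group-peel to a group-core**: while some light group exists, freeze one (each costs `≤ E·2ⁿ`, the number of active cuts drops). -/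
theorem gpeel_to_core (c : ℕ) {E : ℝ} (hE : 0 ≤ E) (L m₀ : ℕ) (θ₁ : ℝ)
    (hstep : ∀ (D : JLinData p n) (G : Finset (Fin (n + 1))), G ∈ D.lightGroups L →
      ∃ κ : Fin (n + 1) → ZMod p, (winCount c D.strat : ℝ) ≤ E * (2 : ℝ) ^ n + (winCount c (D.freezeAll G κ).strat : ℝ))
    (hcore : ∀ D : JLinData p n, (∀ g, (D.J g).card ≤ m₀) → D.lightGroups L = ∅ → (winCount c D.strat : ℝ) ≤ θ₁ * (2 : ℝ) ^ n) :
    ∀ (m : ℕ) (D : JLinData p n), (∀ g, (D.J g).card ≤ m₀) → D.activeSet.card ≤ m →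
      (winCount c D.strat : ℝ) ≤ ((m : ℝ) * E + θ₁) * (2 : ℝ) ^ n := by
  have h2n : (0 : ℝ) < (2 : ℝ) ^ n := by positivity
  intro m
  induction m with
  | zero =>
    intro D hJ hm
    have hcoreD : D.lightGroups L = ∅ := by
      refine lightGroups_eq_empty_of_forall D fun G hG => ?_
      rw [mem_lightGroups] at hG
      obtain ⟨g, hg⟩ := hG.1
      have : g ∈ D.activeSet := hG.2.1 hg
      have h0 : D.activeSet = ∅ := card_eq_zero.1 (Nat.le_zero.1 hm)
      rw [h0] at this
      exact absurd this (by simp)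
    have := hcore D hJ hcoreD
    simpa using this
  | succ m ih =>
    intro D hJ hm
    by_cases hcoreD : D.lightGroups L = ∅
    · have h1 := hcore D hJ hcoreD
      have : θ₁ * (2 : ℝ) ^ n ≤ (((m + 1 : ℕ) : ℝ) * E + θ₁) * (2 : ℝ) ^ n := by
        have : (0 : ℝ) ≤ ((m + 1 : ℕ) : ℝ) * E := mul_nonneg (by positivity) hE
        nlinarith
      exact h1.trans this
    · obtain ⟨G, hG⟩ := nonempty_iff_ne_empty.2 hcoreD
      obtain ⟨κ, hκ⟩ := hstep D G hG
      have hG' := (mem_lightGroups D).1 hG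
      have hcard : (D.freezeAll G κ).activeSet.card ≤ m := by
        rw [activeSet_freezeAll]
        obtain ⟨g, hg⟩ := hG'.1
        have hlt : (D.activeSet \ G).card < D.activeSet.card :=
          card_lt_card ⟨sdiff_subset, fun hsub => (mem_sdiff.1 (hsub (hG'.2.1 hg))).2 hg⟩
        omega
      have hD' := ih (D.freezeAll G κ) (juntaBound_freezeAll D hJ G κ) hcard
      calc (winCount c D.strat : ℝ)
          ≤ E * (2 : ℝ) ^ n + (winCount c (D.freezeAll G κ).strat : ℝ) := hκ
        _ ≤ E * (2 : ℝ) ^ n + (((m : ℕ) : ℝ) * E + θ₁) * (2 : ℝ) ^ n := by linarith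
        _ = (((m + 1 : ℕ) : ℝ) * E + θ₁) * (2 : ℝ) ^ n := by push_cast; ring

/-- **Group-peel to nothing** (the light-cover rung): along a light cover peeling never gets stuck and ends in a junta strategy. -/
theorem gpeel_cover (c : ℕ) {E : ℝ} (hE : 0 ≤ E) (L m₀ : ℕ) (θ₁ : ℝ)
    (hstep : ∀ (D : JLinData p n) (G : Finset (Fin (n + 1))), G ∈ D.lightGroups L →
      ∃ κ : Fin (n + 1) → ZMod p, (winCount c D.strat : ℝ) ≤ E * (2 : ℝ) ^ n + (winCount c (D.freezeAll G κ).strat : ℝ))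
    (hjunta : ∀ D : JLinData p n, (∀ g, (D.J g).card ≤ m₀) → D.activeSet = ∅ → (winCount c D.strat : ℝ) ≤ θ₁ * (2 : ℝ) ^ n) :
    ∀ (m : ℕ) (D : JLinData p n), (∀ g, (D.J g).card ≤ m₀) → (∀ g ∈ D.activeSet, ∃ G ∈ D.lightGroups L, g ∈ G) → D.activeSet.card ≤ m →
      (winCount c D.strat : ℝ) ≤ ((m : ℝ) * E + θ₁) * (2 : ℝ) ^ n := by
  have h2n : (0 : ℝ) < (2 : ℝ) ^ n := by positivity
  intro m
  induction m with
  | zero =>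
    intro D hJ _ hm
    have h0 : D.activeSet = ∅ := card_eq_zero.1 (Nat.le_zero.1 hm)
    have := hjunta D hJ h0
    simpa using this
  | succ m ih =>
    intro D hJ hcov hm
    by_cases h0 : D.activeSet = ∅
    · have h1 := hjunta D hJ h0
      have : θ₁ * (2 : ℝ) ^ n ≤ (((m + 1 : ℕ) : ℝ) * E + θ₁) * (2 : ℝ) ^ n := by
        have : (0 : ℝ) ≤ ((m + 1 : ℕ) : ℝ) * E := mul_nonneg (by positivity) hE
        nlinarith
      exact h1.trans this
    · obtain ⟨g, hg⟩ := nonempty_iff_ne_empty.2 h0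
      obtain ⟨G, hG, hgG⟩ := hcov g hg
      obtain ⟨κ, hκ⟩ := hstep D G hG
      have hcard : (D.freezeAll G κ).activeSet.card ≤ m := by
        rw [activeSet_freezeAll]
        have hlt : (D.activeSet \ G).card < D.activeSet.card :=
          card_lt_card ⟨sdiff_subset, fun hsub => (mem_sdiff.1 (hsub hg)).2 hgG⟩
        omega
      have hD' := ih (D.freezeAll G κ) (juntaBound_freezeAll D hJ G κ) (lightCover_freezeAll D hcov κ) hcard
      calc (winCount c D.strat : ℝ)
          ≤ E * (2 : ℝ) ^ n + (winCount c (D.freezeAll G κ).strat : ℝ) := hκ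
        _ ≤ E * (2 : ℝ) ^ n + (((m : ℕ) : ℝ) * E + θ₁) * (2 : ℝ) ^ n := by linarith
        _ = (((m + 1 : ℕ) : ℝ) * E + θ₁) * (2 : ℝ) ^ n := by push_cast; ring

/-- The per-light-group cost from the law: `C·codeCost ≤ C·p·q^{log₂ n}` once `ρ^{C'} ≤ q ≤ 1/(4p)` and `n ≥ 2`
(`codeCost ≤ p^{|G|}ρ^{L|G|} = (p·ρ^L)^{|G|} ≤ p·ρ^L` because `p·ρ^L ≤ 1`). -/
theorem light_step_cost {C ρ q : ℝ} (hC : 0 ≤ C) (hρ0 : 0 ≤ ρ) (hρ1 : ρ ≤ 1) {C' : ℕ} (hq : ρ ^ C' ≤ q) (hq0 : 0 ≤ q)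
    (hq1 : q ≤ 1 / (4 * p)) {n : ℕ} (hn : 2 ≤ n) (c : ℕ)
    (hstep : ∀ (D : JLinData p n) (G : Finset (Fin (n + 1))), ∃ κ : Fin (n + 1) → ZMod p,
      (winCount c D.strat : ℝ) ≤ C * D.codeCost G ρ * (2 : ℝ) ^ n + (winCount c (D.freezeAll G κ).strat : ℝ)) :
    ∀ (D : JLinData p n) (G : Finset (Fin (n + 1))), G ∈ D.lightGroups (C' * Nat.log 2 n) →
      ∃ κ : Fin (n + 1) → ZMod p, (winCount c D.strat : ℝ) ≤
        C * p * q ^ Nat.log 2 n * (2 : ℝ) ^ n + (winCount c (D.freezeAll G κ).strat : ℝ) := by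
  intro D G hG
  obtain ⟨κ, hκ⟩ := hstep D G
  refine ⟨κ, le_trans hκ ?_⟩
  have hp1 : (1 : ℝ) ≤ p := by exact_mod_cast (Fact.out : p.Prime).one_lt.le
  have hp0 : (0 : ℝ) < p := by linarith
  have hlog : 1 ≤ Nat.log 2 n := Nat.le_log_of_pow_le one_lt_two (by simpa using hn)
  set k := Nat.log 2 n with hk
  -- `ρ^L ≤ q^k`
  have hρL : ρ ^ (C' * k) ≤ q ^ k := by
    rw [pow_mul]; exact pow_le_pow_left₀ (pow_nonneg hρ0 _) hq k
  -- `p·q^k ≤ 1`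
  have hpq : (p : ℝ) * q ^ k ≤ 1 := by
    have hqk : q ^ k ≤ q := by
      calc q ^ k ≤ q ^ 1 := pow_le_pow_of_le_one hq0 (hq1.trans (by
              rw [div_le_iff₀ (by positivity)]; linarith)) hlog
        _ = q := pow_one q
    calc (p : ℝ) * q ^ k ≤ p * (1 / (4 * p)) := mul_le_mul_of_nonneg_left (hqk.trans hq1) hp0.le
      _ = 1 / 4 := by field_simp
      _ ≤ 1 := by norm_num
  have hcc := codeCost_le_of_light D hG hρ0 hρ1
  -- `p^{|G|} ρ^{L|G|} = (p ρ^L)^{|G|} ≤ (p q^k)^{|G|} ≤ p q^k`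
  have hG1 : 1 ≤ G.card := card_pos.2 ((mem_lightGroups D).1 hG).1
  have hx0 : 0 ≤ (p : ℝ) * ρ ^ (C' * k) := by positivity
  have hbound : (p : ℝ) ^ G.card * ρ ^ (C' * k * G.card) ≤ p * q ^ k := by
    rw [pow_mul, ← mul_pow]
    calc ((p : ℝ) * ρ ^ (C' * k)) ^ G.card ≤ ((p : ℝ) * q ^ k) ^ G.card :=
          pow_le_pow_left₀ hx0 (mul_le_mul_of_nonneg_left hρL hp0.le) _
      _ ≤ ((p : ℝ) * q ^ k) ^ 1 := pow_le_pow_of_le_one (by positivity) hpq hG1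
      _ = p * q ^ k := pow_one _
  have h2 : (0 : ℝ) ≤ (2 : ℝ) ^ n := by positivity
  have hfin : C * D.codeCost G ρ * (2 : ℝ) ^ n ≤ C * p * q ^ k * (2 : ℝ) ^ n := by
    have h1 : D.codeCost G ρ ≤ p * q ^ k := hcc.trans hbound
    have := mul_le_mul_of_nonneg_left h1 hC
    have := mul_le_mul_of_nonneg_right this h2
    linarith [this]
  linarith

end GPeel

/-! ### Item 32604 at `p` ⟺ group-core hardness; the light-cover rung -/

/-- **Group-core hardness ⟹ hardness over data** (`p ≠ 3`): peel light groups (`gpeel_to_core`) with the proved law, `≤ n + 1`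
steps of cost `C·p·(1/4p)^(log₂ n)·2ⁿ` each (`light_step_cost`, part 3's `peel_error_small`). -/
theorem data_of_groupCore (p : ℕ) [Fact p.Prime] (hp3 : p ≠ 3)
    (hC : ∀ C' : ℕ, ∃ θ : ℝ, θ < 1 ∧ ∃ n₀ : ℕ, ∀ n ≥ n₀, ∀ (c : ℕ) (D : JLinData p n),
      (∀ g, (D.J g).card ≤ Nat.log 2 n) → D.lightGroups (C' * Nat.log 2 n) = ∅ → (winCount c D.strat : ℝ) ≤ θ * (2 : ℝ) ^ n) :
    ∃ θ : ℝ, θ < 1 ∧ ∃ n₀ : ℕ, ∀ n ≥ n₀, ∀ (c : ℕ) (D : JLinData p n),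
      (∀ g, (D.J g).card ≤ Nat.log 2 n) → (winCount c D.strat : ℝ) ≤ θ * (2 : ℝ) ^ n := by
  obtain ⟨C, ρ, hC0, hρ0, hρ1, hstep⟩ := group_peel_law p hp3
  have hp0 : (0 : ℝ) < p := by exact_mod_cast (Fact.out : p.Prime).pos
  have h4p : (0 : ℝ) < 1 / (4 * p) := by positivity
  obtain ⟨C', hC'⟩ := exists_pow_lt_of_lt_one h4p hρ1
  obtain ⟨θ₁, hθ₁, n₀, hn₀⟩ := hC C'
  have hq4 : (1 : ℝ) / (4 * p) ≤ 1 / 4 := by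
    rw [div_le_div_iff₀ (by positivity) (by norm_num)]
    have : (1 : ℝ) ≤ p := by exact_mod_cast (Fact.out : p.Prime).one_lt.le
    linarith
  obtain ⟨n₁, hn₁⟩ := peel_error_small (C * p) ((1 - θ₁) / 2) (1 / (4 * p)) (by positivity) (by linarith) h4p.le hq4
  refine ⟨(1 + θ₁) / 2, by linarith, max (max n₀ n₁) 2, fun n hn c D hJ => ?_⟩
  have hn0' : n₀ ≤ n := le_trans (le_max_left _ _) (le_trans (le_max_left _ _) hn)
  have hn1' : n₁ ≤ n := le_trans (le_max_right _ _) (le_trans (le_max_left _ _) hn)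
  have hn2 : 2 ≤ n := le_trans (le_max_right _ _) hn
  have hls := light_step_cost (p := p) hC0 hρ0 hρ1.le hC'.le h4p.le le_rfl hn2 c (fun D G => hstep n c D G)
  have hpeel := gpeel_to_core (p := p) (n := n) c (E := C * p * (1 / (4 * p)) ^ Nat.log 2 n) (by positivity)
    (C' * Nat.log 2 n) (Nat.log 2 n) θ₁ hls (fun D' hJ' hc' => hn₀ n hn0' c D' hJ' hc') (n + 1) D hJ (card_activeSet_le D)
  have herr := hn₁ n hn1'
  have h2n : (0 : ℝ) < (2 : ℝ) ^ n := by positivity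
  have hcast : (((n + 1 : ℕ) : ℝ)) = (n : ℝ) + 1 := by push_cast; ring
  rw [hcast] at hpeel
  have : ((n : ℝ) + 1) * (C * p * (1 / (4 * p)) ^ Nat.log 2 n) = ((n : ℝ) + 1) * (C * p) * (1 / (4 * p)) ^ Nat.log 2 n := by
    ring
  rw [this] at hpeel
  nlinarith

/-- The converse is trivial: a group-core is in particular junta ⊕ form data. -/
theorem groupCore_of_data (p : ℕ) [Fact p.Prime]
    (h : ∃ θ : ℝ, θ < 1 ∧ ∃ n₀ : ℕ, ∀ n ≥ n₀, ∀ (c : ℕ) (D : JLinData p n),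
      (∀ g, (D.J g).card ≤ Nat.log 2 n) → (winCount c D.strat : ℝ) ≤ θ * (2 : ℝ) ^ n) :
    ∀ C' : ℕ, ∃ θ : ℝ, θ < 1 ∧ ∃ n₀ : ℕ, ∀ n ≥ n₀, ∀ (c : ℕ) (D : JLinData p n),
      (∀ g, (D.J g).card ≤ Nat.log 2 n) → D.lightGroups (C' * Nat.log 2 n) = ∅ → (winCount c D.strat : ℝ) ≤ θ * (2 : ℝ) ^ n := fun C' => by
  obtain ⟨θ, hθ, n₀, hn₀⟩ := h
  exact ⟨θ, hθ, n₀, fun n hn c D hJ _ => hn₀ n hn c D hJ⟩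

/-- **Item 32604 at `p` ⟺ hardness on GROUP-CORES** (`p ≠ 3`; PROVED REDUCTION, law discharged). -/
theorem pres_iff_groupCore (p : ℕ) [Fact p.Prime] (hp3 : p ≠ 3) :
    (∃ θ : ℝ, θ < 1 ∧ ∃ n₀ : ℕ, ∀ n ≥ n₀, ∀ c : ℕ, ∀ y : Fin (n + 1) → (Fin n → Bool) → Bool,
      (∀ g, ∃ J : Finset (Fin n), J.card ≤ Nat.log 2 n ∧ ∃ a : Fin n → ZMod p, ∃ h : (Fin n → Bool) → ZMod p → Bool,
          (∀ u v : Fin n → Bool, (∀ i ∈ J, u i = v i) → ∀ s, h u s = h v s) ∧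
            ∀ u, y g u = h u (∑ i, if u i then a i else 0)) →
        ((Finset.univ.filter fun u : Fin n → Bool => ringWinU c y u = true).card : ℝ) ≤ θ * (2 : ℝ) ^ n) ↔
    (∀ C' : ℕ, ∃ θ : ℝ, θ < 1 ∧ ∃ n₀ : ℕ, ∀ n ≥ n₀, ∀ (c : ℕ) (D : JLinData p n),
      (∀ g, (D.J g).card ≤ Nat.log 2 n) → D.lightGroups (C' * Nat.log 2 n) = ∅ → (winCount c D.strat : ℝ) ≤ θ * (2 : ℝ) ^ n) :=
  ⟨fun h => groupCore_of_data p (data_of_pres p h), fun hC => pres_of_data p (data_of_groupCore p hp3 hC)⟩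

/-- Part 5's residual (cores) ⟺ this part's (group-cores) (`p ≠ 3`). -/
theorem core_iff_groupCore (p : ℕ) [Fact p.Prime] (hp3 : p ≠ 3) :
    (∀ C' : ℕ, ∃ θ : ℝ, θ < 1 ∧ ∃ n₀ : ℕ, ∀ n ≥ n₀, ∀ (c : ℕ) (D : JLinData p n),
      (∀ g, (D.J g).card ≤ Nat.log 2 n) → (∀ g, (D.suppForm g).Nonempty → D.priv g < C' * Nat.log 2 n) →
        (winCount c D.strat : ℝ) ≤ θ * (2 : ℝ) ^ n) ↔
    (∀ C' : ℕ, ∃ θ : ℝ, θ < 1 ∧ ∃ n₀ : ℕ, ∀ n ≥ n₀, ∀ (c : ℕ) (D : JLinData p n),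
      (∀ g, (D.J g).card ≤ Nat.log 2 n) → D.lightGroups (C' * Nat.log 2 n) = ∅ → (winCount c D.strat : ℝ) ≤ θ * (2 : ℝ) ^ n) :=
  (pres_iff_core p hp3).symm.trans (pres_iff_groupCore p hp3)

/-- **The LIGHT-COVER rung, UNCONDITIONALLY** (`p ≠ 3`): group-peel everything along the cover (`gpeel_cover`), junta base =
the tree's `walkHardFJuntaCuts` through part 5's `win_le_of_inactive`. -/
theorem lightCover_hard (p : ℕ) [Fact p.Prime] (hp3 : p ≠ 3) :
    ∃ C' : ℕ, ∃ θ : ℝ, θ < 1 ∧ ∃ n₀ : ℕ, ∀ n ≥ n₀, ∀ (c : ℕ) (D : JLinData p n),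
      (∀ g, (D.J g).card ≤ Nat.log 2 n) → (∀ g ∈ D.activeSet, ∃ G ∈ D.lightGroups (C' * Nat.log 2 n), g ∈ G) → (winCount c D.strat : ℝ) ≤ θ * (2 : ℝ) ^ n := by
  obtain ⟨C, ρ, hC0, hρ0, hρ1, hstep⟩ := group_peel_law p hp3
  have hp0 : (0 : ℝ) < p := by exact_mod_cast (Fact.out : p.Prime).pos
  have h4p : (0 : ℝ) < 1 / (4 * p) := by positivity
  obtain ⟨C', hC'⟩ := exists_pow_lt_of_lt_one h4p hρ1
  obtain ⟨θJ, hθJ, hJall⟩ := walkHardFJuntaCuts p hp3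
  obtain ⟨n₀, hn₀⟩ := hJall 1
  have hq4 : (1 : ℝ) / (4 * p) ≤ 1 / 4 := by
    rw [div_le_div_iff₀ (by positivity) (by norm_num)]
    have : (1 : ℝ) ≤ p := by exact_mod_cast (Fact.out : p.Prime).one_lt.le
    linarith
  obtain ⟨n₁, hn₁⟩ := peel_error_small (C * p) ((1 - θJ) / 2) (1 / (4 * p)) (by positivity) (by linarith) h4p.le hq4
  refine ⟨C', (1 + θJ) / 2, by linarith, max (max n₀ n₁) 2, fun n hn c D hJ hcov => ?_⟩
  have hn0' : n₀ ≤ n := le_trans (le_max_left _ _) (le_trans (le_max_left _ _) hn)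
  have hn1' : n₁ ≤ n := le_trans (le_max_right _ _) (le_trans (le_max_left _ _) hn)
  have hn2 : 2 ≤ n := le_trans (le_max_right _ _) hn
  have hls := light_step_cost (p := p) hC0 hρ0 hρ1.le hC'.le h4p.le le_rfl hn2 c (fun D G => hstep n c D G)
  have hpeel := gpeel_cover (p := p) (n := n) c (E := C * p * (1 / (4 * p)) ^ Nat.log 2 n) (by positivity)
    (C' * Nat.log 2 n) (Nat.log 2 n) θJ hls (fun D' hJ' h0 => win_le_of_inactive p hn₀ hn0' c D' hJ' h0) (n + 1) D hJ hcov
    (card_activeSet_le D)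
  have herr := hn₁ n hn1'
  have h2n : (0 : ℝ) < (2 : ℝ) ^ n := by positivity
  have hcast : (((n + 1 : ℕ) : ℝ)) = (n : ℝ) + 1 := by push_cast; ring
  rw [hcast] at hpeel
  have : ((n : ℝ) + 1) * (C * p * (1 / (4 * p)) ^ Nat.log 2 n) = ((n : ℝ) + 1) * (C * p) * (1 / (4 * p)) ^ Nat.log 2 n := by
    ring
  rw [this] at hpeel
  nlinarith

/-- W-edge: hardness over data (hence item 32604 at `p`) implies the light-cover statement (`C' = 1`). -/
theorem lightCover_of_data (p : ℕ) [Fact p.Prime]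
    (h : ∃ θ : ℝ, θ < 1 ∧ ∃ n₀ : ℕ, ∀ n ≥ n₀, ∀ (c : ℕ) (D : JLinData p n),
      (∀ g, (D.J g).card ≤ Nat.log 2 n) → (winCount c D.strat : ℝ) ≤ θ * (2 : ℝ) ^ n) :
    ∃ C' : ℕ, ∃ θ : ℝ, θ < 1 ∧ ∃ n₀ : ℕ, ∀ n ≥ n₀, ∀ (c : ℕ) (D : JLinData p n),
      (∀ g, (D.J g).card ≤ Nat.log 2 n) → (∀ g ∈ D.activeSet, ∃ G ∈ D.lightGroups (C' * Nat.log 2 n), g ∈ G) → (winCount c D.strat : ℝ) ≤ θ * (2 : ℝ) ^ n := by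
  obtain ⟨θ, hθ, n₀, hn₀⟩ := h
  exact ⟨1, θ, hθ, n₀, fun n hn c D hJ _ => hn₀ n hn c D hJ⟩

/-- **R5 `WalkHardFLinSel p` ⟸ group-core hardness** (`p ≠ 3`). -/
theorem walkHardFLinSel_of_groupCore (p : ℕ) [Fact p.Prime] (hp3 : p ≠ 3)
    (hC : ∀ C' : ℕ, ∃ θ : ℝ, θ < 1 ∧ ∃ n₀ : ℕ, ∀ n ≥ n₀, ∀ (c : ℕ) (D : JLinData p n),
      (∀ g, (D.J g).card ≤ Nat.log 2 n) → D.lightGroups (C' * Nat.log 2 n) = ∅ → (winCount c D.strat : ℝ) ≤ θ * (2 : ℝ) ^ n) :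
    WalkHardFLinSel p :=
  walkHardFLinSel_of_pres p ((pres_iff_groupCore p hp3).2 hC)

end Summit.QuantumAdvantage.AdviceFreeQNC0.JLinPeel

end
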